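import Literature.MathematicalPhysics.QuantumFieldTheory.Balaban1983to89.B13Replacement223
import Literature.MathematicalPhysics.QuantumFieldTheory.Balaban1983to89.B13CovarianceDifference216
import Literature.Analysis.Complex.HolomorphicParametricIntegral

/-!
# `Balaban1983to89.B13GaussParamHolomorphic` — T. Bałaban, *Renormalization group approach to lattice gauge field
theories. II. Cluster expansions*, Commun. Math. Phys. **116** (1988) 1–22 [Balaban1988RG2Cluster], p. 15: the complex
Gaussian means of the display (2.14) are HOLOMORPHIC in any complex parameters on which their operators depend
holomorphically — generic part (normalisation, unnormalised integral, mean; matrix fields)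

statement-level skeleton of published theorems with citation tags; proofs where landed; nothing here is a claim about
the Yang–Mills mass gap

CITATION HEADER (verbatim).  P. 15 [PDF 15], around (2.14): *"This term can be written in the following form: (2.14) …
We consider it as an analytic function … of the complex parameters σ(Z), τ … For the pair (U, 0) the operators are
symmetric, and the measure is positive, and then the estimates are simpler. The general case is handled by a
perturbative argument."*  P. 15, after (2.14): *"the second measure is complex"*.

WHAT IS PROVED HERE (cell `pub-balaban-gaps`, seat ne5 gen 6; the tree so far takes the printed analyticity as the
HYPOTHESIS `B13Term214.SepHolOn` — `hΨσ`, `hΨτ` of `B13Term214.term214_eq_DopC`, `B13Representation214.H28_eq_term214`,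
`B13Lemma3TorusPrimitive.h226_torus_of_primitives`; this file and its sequel `B13Core214Holomorphic` DERIVE it from
primitive data).  Over the finite-dimensional block model of record (`B13Term214`: complex precision `A`, real fields,
Lebesgue reference measure) and for operator families depending on a parameter `p` of an arbitrary complex normed
space `P` (the cell's uses: `P = ι → ℂ` for `σ(Z)`, `P = κ → ℂ` for `τ`, `P = E × ℂ` for row NE5's (background,
interpolation) pencil):
* §1 `differentiableOn_dotProduct` — bilinear pairings of holomorphic vector fields are holomorphic; the determinant ∕
  adjugate ∕ inverse of a matrix field with holomorphic entries are holomorphic BY NAME from the tree's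
  `B13CovarianceDifference216.differentiableOn_matrix_det ∕ _adjugate ∕ _inv` (p343380; not restated here);
* §2 `differentiableOn_cquad ∕ _cgaussWeight` — the complex quadratic form and the complex Gaussian weight
  `e^{−½⟨B, A(p)B⟩}` are holomorphic in `p` at every real field `B`;
* §3 `differentiableOn_cgaussInt_of_dominated` — the unnormalised complex Gaussian integral
  `∫dB e^{−½⟨B,A(p)B⟩} Ψ(p, B)` is holomorphic in `p` on an open set `V` when `Ψ(·, B)` is holomorphic for every `B`,
  `Ψ(p, ·)` is measurable, and the integrand has ONE integrable majorant on `V`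
  (`Literature.Analysis.Complex.differentiableOn_integral_of_dominated` — holomorphy under the integral sign; no
  hypothesis on derivatives);
* §4 `differentiableOn_cgaussNorm_of_dominated`, `det_ne_zero_of_re_posDef`, `differentiableOn_cgaussMean_of_dominated` —
  the normalisation is holomorphic and zero-free while `Re A(p) ≻ 0` (`B13FirstEstimate215.cgaussNorm_ne_zero`), hence
  so is the complex Gaussian MEAN `dμ_{A(p)⁻¹}` applied to a holomorphic family of integrands.
The sequel applies §1–§4 to lines 2–4 of (2.14) (`B13Term214.integrand214`, `core214`) with the majorants of
(2.15)–(2.23) (`B13FirstEstimate215`, `B13Replacement223`, `B13Integral223`) supplying the domination.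

HONEST FRAMING.  Generic finite-dimensional complex analysis over the block model; every operator family is a
HYPOTHESIS (a map from the parameter space); nothing of Bałaban's `Γ_k(Z₀,σ)`, `C^{(k)}(Z₀,σ)` is constructed or
asserted; (D4) instance 0∕1 and the T⁴ spine 0∕9 UNCHANGED; NOT continuum, NOT infinite volume, NOT mass gap, NOT Clay.
References (TYPES ∕ LOCUS only): [Balaban1988RG2Cluster] (2.14)–(2.15) p. 15.  Tools: Mathlib; the tree's
`HolomorphicParametricIntegral` [folklore].  0 sorry, 0 `def`.
-/

noncomputable section

namespace Literature.MathematicalPhysics.QuantumFieldTheory.Balaban1983to89.B13GaussParamHolomorphic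

open Matrix MeasureTheory Finset Complex Metric Set
open scoped Real
open B13GaugeDevices (gaussWeight gaussInt gaussNorm gaussMean)
open B2Eq228Conditioning (gaussNorm_pos integrable_gaussWeight)
open B13Term214 (cquad cgaussWeight cgaussInt cgaussNorm cgaussMean)
open B13FirstEstimate215 (cgaussNorm_ne_zero norm_cgaussWeight_eq_gaussWeight)
open Literature.Analysis.Complex (differentiableOn_integral_of_dominated)

/-! ## §1. Vector fields with holomorphic entries: bilinear pairings (matrix det ∕ adj ∕ inverse: `B13CovarianceDifference216` §3) -/

section MatrixField

variable {𝕜 : Type*} [NontriviallyNormedField 𝕜] {P : Type*} [NormedAddCommGroup P] [NormedSpace 𝕜 P]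
variable {ι : Type*} [Fintype ι] {s : Set P}

/-- Dot products of two vector fields with differentiable entries are differentiable (the bilinear pairings
`⟨Γ(σ)X, A(σ)⁻¹Γ(σ)X⟩`, `⟨B, Γ(σ)X⟩` of (2.14)). [cite: Balaban1988RG2Cluster, (2.14) p.15] (elementary API: analyticity in the parameters) -/
theorem differentiableOn_dotProduct {v w : P → ι → 𝕜} (hv : ∀ i, DifferentiableOn 𝕜 (fun y => v y i) s)
    (hw : ∀ i, DifferentiableOn 𝕜 (fun y => w y i) s) :
    DifferentiableOn 𝕜 (fun y => v y ⬝ᵥ w y) s := by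
  simp only [dotProduct]
  exact DifferentiableOn.fun_sum fun i _ => (hv i).mul (hw i)

end MatrixField

/-! ## §2. The complex quadratic form and the complex Gaussian weight are holomorphic in the parameter -/

section Weight

variable {Λ : Type} [Fintype Λ] [DecidableEq Λ]
variable {P : Type*} [NormedAddCommGroup P] [NormedSpace ℂ P] {V : Set P}

omit [DecidableEq Λ] in
/-- `p ↦ ⟨B, A(p)B⟩` is holomorphic at every real field `B` when the entries of `A` are.
[cite: Balaban1988RG2Cluster, (2.14) p.15] (elementary API for (2.14)) -/
theorem differentiableOn_cquad {A : P → Matrix Λ Λ ℂ} (hA : ∀ i j, DifferentiableOn ℂ (fun p => A p i j) V)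
    (B : Λ → ℝ) : DifferentiableOn ℂ (fun p => cquad (A p) B) V := by
  unfold cquad
  exact DifferentiableOn.fun_sum fun i _ => DifferentiableOn.fun_sum fun j _ =>
    ((differentiableOn_const _).mul (hA i j)).mul (differentiableOn_const _)

omit [DecidableEq Λ] in
/-- `p ↦ e^{−½⟨B, A(p)B⟩}` is holomorphic at every real field `B` when the entries of `A` are.
[cite: Balaban1988RG2Cluster, (2.14) p.15] (elementary API for (2.14)) -/
theorem differentiableOn_cgaussWeight {A : P → Matrix Λ Λ ℂ} (hA : ∀ i j, DifferentiableOn ℂ (fun p => A p i j) V)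
    (B : Λ → ℝ) : DifferentiableOn ℂ (fun p => cgaussWeight (A p) B) V := by
  unfold cgaussWeight
  exact ((differentiableOn_const _).mul (differentiableOn_cquad hA B)).cexp

omit [DecidableEq Λ] in
/-- The complex Gaussian weight is continuous in the field (a polynomial under `exp`).
[cite: Balaban1988RG2Cluster, (2.14) p.15] (elementary API for (2.14)) -/
theorem continuous_cgaussWeight (A : Matrix Λ Λ ℂ) : Continuous (cgaussWeight A) := by
  unfold cgaussWeight cquad
  fun_prop

end Weight

/-! ## §3. The unnormalised complex Gaussian integral of a holomorphic family is holomorphic (domination) -/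

section Integral

variable {Λ : Type} [Fintype Λ] [DecidableEq Λ]
variable {P : Type*} [NormedAddCommGroup P] [NormedSpace ℂ P] {V : Set P}

omit [DecidableEq Λ] in
/-- **Holomorphy under the complex Gaussian integral sign.**  If the entries of `A(p)` are holomorphic on an open `V`,
`Ψ(·, B)` is holomorphic on `V` for every field `B`, `Ψ(p, ·)` is a.e.-strongly measurable for `p ∈ V`, and the
integrand `e^{−½⟨B,A(p)B⟩}Ψ(p,B)` is dominated on `V` by ONE integrable function of `B`, then
`p ↦ ∫dB e^{−½⟨B,A(p)B⟩} Ψ(p, B)` (`B13Term214.cgaussInt`) is holomorphic on `V`.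
[cite: Balaban1988RG2Cluster, (2.14)–(2.15) p.15] -/
theorem differentiableOn_cgaussInt_of_dominated (hV : IsOpen V) {A : P → Matrix Λ Λ ℂ}
    (hA : ∀ i j, DifferentiableOn ℂ (fun p => A p i j) V) {Ψ : P → (Λ → ℝ) → ℂ}
    (hΨd : ∀ B, DifferentiableOn ℂ (fun p => Ψ p B) V) (hΨm : ∀ p ∈ V, AEStronglyMeasurable (Ψ p) volume)
    {bound : (Λ → ℝ) → ℝ} (hbound : Integrable bound)
    (hdom : ∀ p ∈ V, ∀ B, ‖cgaussWeight (A p) B * Ψ p B‖ ≤ bound B) :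
    DifferentiableOn ℂ (fun p => cgaussInt (A p) (Ψ p)) V := by
  unfold cgaussInt
  refine differentiableOn_integral_of_dominated (fun p hp => ?_) (ae_of_all _ fun B => ?_) (fun x₀ hx₀ => ?_)
  · exact (continuous_cgaussWeight (A p)).aestronglyMeasurable.mul (hΨm p hp)
  · exact (differentiableOn_cgaussWeight hA B).mul (hΨd B)
  · obtain ⟨R, hR, hball⟩ := Metric.isOpen_iff.1 hV x₀ hx₀
    exact ⟨R, hR, hball, bound, hbound, ae_of_all _ fun B p hp => hdom p (hball hp) B⟩

end Integral

/-! ## §4. The normalisation is holomorphic and zero-free; the complex Gaussian mean is holomorphic -/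

section Mean

variable {Λ : Type} [Fintype Λ] [DecidableEq Λ]
variable {P : Type*} [NormedAddCommGroup P] [NormedSpace ℂ P] {V : Set P}

/-- `Re A ≻ 0` ⟹ `det A ≠ 0` for a complex symmetric precision (from `cgaussNorm_ne_zero`).
[cite: Balaban1988RG2Cluster, (2.14)–(2.15) p.15] (elementary API for (2.15)) -/
theorem det_ne_zero_of_re_posDef {A : Matrix Λ Λ ℂ} (hAs : A.IsSymm) (hA : (A.map Complex.re).PosDef) :
    A.det ≠ 0 :=
  (cgaussNorm_ne_zero hAs hA).2

omit [DecidableEq Λ] in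
/-- The modulus of the complex weight is dominated by the weight of any real `M` below `Re A(p)`:
`‖e^{−½⟨B,A(p)B⟩}‖ ≤ e^{−½⟨B,MB⟩}` when `⟨B, MB⟩ ≤ ⟨B, Re A(p) B⟩`. [cite: Balaban1988RG2Cluster, (2.15) p.15] (elementary API for (2.15)) -/
theorem norm_cgaussWeight_le_gaussWeight {A : Matrix Λ Λ ℂ} {M : Matrix Λ Λ ℝ} (B : Λ → ℝ)
    (hM : B ⬝ᵥ (M *ᵥ B) ≤ B ⬝ᵥ (A.map Complex.re *ᵥ B)) :
    ‖cgaussWeight A B‖ ≤ gaussWeight M B := by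
  rw [norm_cgaussWeight_eq_gaussWeight, gaussWeight, gaussWeight]
  exact Real.exp_le_exp.2 (by linarith)

/-- **The complex normalisation `∫dB e^{−½⟨B,A(p)B⟩}` is holomorphic** on an open `V` on which the entries of `A` are
holomorphic and `Re A(p)` dominates ONE positive definite real `M` (so `e^{−½⟨B,MB⟩}` is a common integrable
majorant). [cite: Balaban1988RG2Cluster, (2.14)–(2.15) p.15] -/
theorem differentiableOn_cgaussNorm (hV : IsOpen V) {A : P → Matrix Λ Λ ℂ}
    (hA : ∀ i j, DifferentiableOn ℂ (fun p => A p i j) V) {M : Matrix Λ Λ ℝ} (hM : M.PosDef)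
    (hAM : ∀ p ∈ V, ∀ B : Λ → ℝ, B ⬝ᵥ (M *ᵥ B) ≤ B ⬝ᵥ ((A p).map Complex.re *ᵥ B)) :
    DifferentiableOn ℂ (fun p => cgaussNorm (A p)) V := by
  have h := differentiableOn_cgaussInt_of_dominated hV hA (Ψ := fun _ _ => (1 : ℂ))
    (fun B => differentiableOn_const _) (fun p _ => aestronglyMeasurable_const) (integrable_gaussWeight hM)
    (fun p hp B => by rw [mul_one]; exact norm_cgaussWeight_le_gaussWeight B (hAM p hp B))
  refine h.congr fun p _ => ?_
  simp only [cgaussNorm, cgaussInt, mul_one]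

/-- **The complex Gaussian MEAN of a holomorphic family is holomorphic**: with the data of
`differentiableOn_cgaussInt_of_dominated`, `A(p)` symmetric with `Re A(p) ≻ 0` dominating a fixed positive definite
`M` on `V`, the mean `∫dμ_{A(p)⁻¹}(B) Ψ(p, B) = (∫dB e^{−½⟨B,A(p)B⟩})⁻¹ ∫dB e^{−½⟨B,A(p)B⟩}Ψ(p,B)`
(`B13Term214.cgaussMean`) is holomorphic on `V` (the normalisation is zero-free, `cgaussNorm_ne_zero`).
[cite: Balaban1988RG2Cluster, (2.14)–(2.15) p.15] -/
theorem differentiableOn_cgaussMean_of_dominated (hV : IsOpen V) {A : P → Matrix Λ Λ ℂ}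
    (hA : ∀ i j, DifferentiableOn ℂ (fun p => A p i j) V)
    (hAs : ∀ p ∈ V, (A p).IsSymm) (hApos : ∀ p ∈ V, ((A p).map Complex.re).PosDef)
    {M : Matrix Λ Λ ℝ} (hM : M.PosDef)
    (hAM : ∀ p ∈ V, ∀ B : Λ → ℝ, B ⬝ᵥ (M *ᵥ B) ≤ B ⬝ᵥ ((A p).map Complex.re *ᵥ B))
    {Ψ : P → (Λ → ℝ) → ℂ}
    (hΨd : ∀ B, DifferentiableOn ℂ (fun p => Ψ p B) V) (hΨm : ∀ p ∈ V, AEStronglyMeasurable (Ψ p) volume)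
    {bound : (Λ → ℝ) → ℝ} (hbound : Integrable bound)
    (hdom : ∀ p ∈ V, ∀ B, ‖cgaussWeight (A p) B * Ψ p B‖ ≤ bound B) :
    DifferentiableOn ℂ (fun p => cgaussMean (A p) (Ψ p)) V := by
  unfold cgaussMean
  exact ((differentiableOn_cgaussNorm hV hA hM hAM).inv fun p hp => (cgaussNorm_ne_zero (hAs p hp) (hApos p hp)).1).mul
    (differentiableOn_cgaussInt_of_dominated hV hA hΨd hΨm hbound hdom)

end Mean

end Literature.MathematicalPhysics.QuantumFieldTheory.Balaban1983to89.B13GaussParamHolomorphic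

end
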